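import Mathlib.Analysis.Asymptotics.AsymptoticEquivalent
import Mathlib.Data.ZMod.Basic
import Mathlib.Algebra.Squarefree.Basic
import Literature.NumberTheory.EllipticCurves.MordellWeil
import Literature.NumberTheory.EllipticCurves.AnalyticRank
import Literature.NumberTheory.EllipticCurves.GlobalMinimalModel
import Literature.NumberTheory.EllipticCurves.BSDWave0
import HarnessLib

-- provenance: harness21/H21/H21/Statements/BSD/AnalyticRank.lean @ 7fd1621 (interim HEAD d8f2665); M5 mechanical rewrite
/-!
# BSD family — statements about the analytic rank

Family `bsd`, trunk T-ELLARITH (outline `TranscendEllArithS`, §3, statement file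
`Statements/BSD/AnalyticRank.lean`). This file states:

* **bsd.S09** (definition of the analytic rank and of the leading coefficient; Birch and
  Swinnerton-Dyer, J. reine angew. Math. 218 (1965); Wiles, *The Birch and Swinnerton-Dyer
  conjecture*, Clay 2006): `analyticRank_def`, `hasEntireLFunction_of_isElliptic`,
  `leadingLCoeff_def`, restating the prelude definitions
  `WeierstrassCurve.analyticRank`, `WeierstrassCurve.leadingLCoeff`
  (`Literature.Prelude.TranscendEllArithS.AnalyticRank`);
* **bsd.S01** (BSD rank conjecture; BSD 1965; Tate, Invent. Math. 23 (1974) Conj. 4a; Wiles, Clay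
  2006): `BSDRankConjecture`, an open conjecture stated as `def … : Prop`;
* **bsd.S29**, converse direction of Tunnell's theorem under BSD(RANK) for the congruent number
  curve `E_n : y² = x³ - n² x` (Tunnell, Invent. Math. 72 (1983); Koblitz, *Introduction to
  Elliptic Curves and Modular Forms*, Ch. IV): `tunnell_converse_odd`, `tunnell_converse_even`,
  with exactly the conventions of the unconditional direction `Literature.NumberTheory.EllipticCurves.tunnell_odd`,
  `Literature.NumberTheory.EllipticCurves.tunnell_even` of `Literature.Statements.BSD.Wave0`;
* **bsd.S35** (Goldfeld, C. R. Acad. Sci. Paris 294 (1982) 471–474; K. Conrad, *Partial Euler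
  products on the critical line*, Canad. J. Math. 57 (2005) Thm 1.1 and Cor. 5.7; Kuo–Murty,
  *On a conjecture of Birch and Swinnerton-Dyer*, Canad. J. Math. 57 (2005)): the original BSD
  asymptotic `∏_{p ≤ x} N_p / p ∼ C (log x)^r` implies `L(E,s) ≠ 0` on `Re s > 1` and
  `ord_{s=1} L(E,s) = r`.

It also records the untagged bridge `mordellWeilRank_eq_wave0`: the Wave0 rank
`Literature.NumberTheory.EllipticCurves.mordellWeilRank` and the prelude rank `WeierstrassCurve.mordellWeilRank` are the same term.

## Design choices

* Group rules of the outline (§0): `noncomputable section`, `open scoped Classical`, no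
  `[DecidableEq]` variables; everything from Wave0 (`IsCongruentNumber`, `ternaryFormRepCount`,
  `mordellWeilRank`) is imported, never redefined.
* Mathlib search: Mathlib (pin v4.32.0) has `WeierstrassCurve.LSeries` but no analytic rank, no BSD
  conjecture, no congruent number curve and no Goldfeld-type statement (searched `analyticRank`,
  `Swinnerton`, `congruent`, `Goldfeld`, `Tunnell` in `Mathlib/`); `Asymptotics.IsEquivalent`
  (`~[atTop]`) is Mathlib's and is used for the asymptotic hypothesis of bsd.S35.
* bsd.S35, sign of the exponent: with `N_p / p = 1 - a_p/p + 1/p = L_p(E,1)⁻¹` the partial products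
  approximate `1 / L(E,s)` near `s = 1`, so they *grow* like `(log x)^r` when `L` vanishes to order
  `r`; this is the asymptotic `∏_{p ≤ x} N_p/p ∼ C (log x)^r` of Birch–Swinnerton-Dyer ((1.1) of
  Conrad), reciprocal to Goldfeld's / Conrad's `Prod(E,x) ∼ C/(log x)^r` (Conrad (1.2), Thm 1.1),
  and it is the one stated here. (The one-line inventory
  summary writes the exponent as `-r`; we follow the cited theorems.)
-/

noncomputable section

open scoped Classical

open Filter Asymptotics WeierstrassCurve

namespace Literature.NumberTheory.EllipticCurves

/-! ### bsd.S09 — analytic rank and leading coefficient -/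

section AnalyticRank

/-- **bsd.S09** (analytic rank; Birch–Swinnerton-Dyer, J. reine angew. Math. 218 (1965); Wiles,
*The Birch and Swinnerton-Dyer conjecture*, Clay 2006). The analytic rank `r_an(E)` of a Weierstrass
curve over `ℚ` is the order of vanishing at `s = 1` of the entire continuation `W.entireLFunction`
of `L(E,s)`, i.e. Mathlib's `analyticOrderNatAt` of that function at `1`. [cite: Clay2006] -/
theorem analyticRank_def (W : WeierstrassCurve ℚ) :
    W.analyticRank = analyticOrderNatAt W.entireLFunction 1 :=
  rfl

/-- **bsd.S09** (existence of the entire continuation over `ℚ`; Wiles, Ann. of Math. 141 (1995);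
Breuil–Conrad–Diamond–Taylor, JAMS 14 (2001) Thm A; Wiles, Clay 2006). For an elliptic curve over
`ℚ` the L-series `L(E,s)` has an entire continuation, so that `W.entireLFunction` is a genuine (not
junk) continuation and `W.analyticRank` is the order of vanishing of `L(E,s)` at `s = 1`.
Deprecated duplicate (same statement) of `WeierstrassCurve.hasEntireLFunction_rat` of
`Literature.NumberTheory.EllipticCurves.AnalyticRank`; use that name.
[cite: BCDTJAMS2001, Theorem A] [cite: Clay2006] -/
@[deprecated WeierstrassCurve.hasEntireLFunction_rat (since := "2026-08-13")]
alias BSDAnalyticRank.hasEntireLFunction_of_isElliptic := WeierstrassCurve.hasEntireLFunction_rat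

/- interim proof relied on results that are now named facts (D-0014); demoted to a fact by the M5
import, proof preserved:
:=
  W.hasEntireLFunction_rat
-/

/-- **bsd.S09** (leading coefficient; Birch–Swinnerton-Dyer 1965; Wiles, Clay 2006). The leading
Taylor coefficient of `L(E,s)` at `s = 1` is `L^{(r)}(E,1) / r!` with `r = r_an(E)` the analytic
rank, computed from Mathlib's `iteratedDeriv` of the entire continuation.
[cite: BirchSwinnertonDyer1965] -/
theorem leadingLCoeff_def (W : WeierstrassCurve ℚ) :
    W.leadingLCoeff =
      iteratedDeriv W.analyticRank W.entireLFunction 1 / (W.analyticRank.factorial : ℂ) :=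
  rfl

/-- Bridge lemma (untagged): the Wave0 Mordell–Weil rank `Literature.BSD.mordellWeilRank W` of
`Literature.Statements.BSD.Wave0` and the prelude rank `WeierstrassCurve.mordellWeilRank W` of
`Literature.Prelude.TranscendEllArithS.MordellWeil` are definitionally the same term
`Module.finrank ℤ E(F)` (Silverman, *The Arithmetic of Elliptic Curves*, VIII.6). [folklore] -/
theorem mordellWeilRank_eq_wave0 {F : Type*} [Field F] (W : WeierstrassCurve F) :
    Literature.NumberTheory.EllipticCurves.mordellWeilRank W = W.mordellWeilRank :=
  rfl

end AnalyticRank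

/-! ### bsd.S01 — the BSD rank conjecture -/

section Rank

end Rank

/-! ### bsd.S29 — Tunnell's theorem, converse direction under BSD(RANK) -/

section Tunnell

/-- The congruent number curve `E_n : y² = x³ - n² x` over `ℚ`, as the Weierstrass equation with
`a₁ = a₂ = a₃ = a₆ = 0`, `a₄ = -n²` (Koblitz, *Introduction to Elliptic Curves and Modular Forms*,
Ch. I §2; Tunnell, Invent. Math. 72 (1983)). A squarefree `n ≥ 1` is a congruent number iff
`E_n(ℚ)` has positive rank. [folklore] -/
def congruentNumberCurve (n : ℕ) : WeierstrassCurve ℚ :=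
  ⟨0, 0, 0, -((n : ℚ) ^ 2), 0⟩

/-- `E_n` has `a₁ = 0` (Koblitz, Ch. I §2). [folklore] -/
@[simp] lemma congruentNumberCurve_a₁ (n : ℕ) : (congruentNumberCurve n).a₁ = 0 := rfl

/-- `E_n` has `a₂ = 0` (Koblitz, Ch. I §2). [folklore] -/
@[simp] lemma congruentNumberCurve_a₂ (n : ℕ) : (congruentNumberCurve n).a₂ = 0 := rfl

/-- `E_n` has `a₃ = 0` (Koblitz, Ch. I §2). [folklore] -/
@[simp] lemma congruentNumberCurve_a₃ (n : ℕ) : (congruentNumberCurve n).a₃ = 0 := rfl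

/-- `E_n` has `a₄ = -n²` (Koblitz, Ch. I §2). [folklore] -/
@[simp] lemma congruentNumberCurve_a₄ (n : ℕ) :
    (congruentNumberCurve n).a₄ = -((n : ℚ) ^ 2) := rfl

/-- `E_n` has `a₆ = 0` (Koblitz, Ch. I §2). [folklore] -/
@[simp] lemma congruentNumberCurve_a₆ (n : ℕ) : (congruentNumberCurve n).a₆ = 0 := rfl

/-- The discriminant of `E_n : y² = x³ - n² x` is `Δ = 64 n⁶` (Koblitz, Ch. I §2; direct
computation from Mathlib's formula for `WeierstrassCurve.Δ`). [folklore] -/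
theorem congruentNumberCurve_Δ (n : ℕ) : (congruentNumberCurve n).Δ = 64 * (n : ℚ) ^ 6 := by
  simp only [congruentNumberCurve, WeierstrassCurve.Δ, WeierstrassCurve.b₂, WeierstrassCurve.b₄,
    WeierstrassCurve.b₆, WeierstrassCurve.b₈]
  ring

/-- For `n ≠ 0` the congruent number curve `E_n` is an elliptic curve (`Δ = 64 n⁶ ≠ 0`;
Koblitz, Ch. I §2). [folklore] -/
theorem isElliptic_congruentNumberCurve {n : ℕ} (hn : n ≠ 0) :
    (congruentNumberCurve n).IsElliptic := by
  rw [WeierstrassCurve.isElliptic_iff, congruentNumberCurve_Δ, isUnit_iff_ne_zero]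
  have : (n : ℚ) ≠ 0 := by exact_mod_cast hn
  exact mul_ne_zero (by norm_num) (pow_ne_zero 6 this)

/-- **bsd.S29** (Tunnell's theorem, converse direction, odd case; Tunnell, *A classical
Diophantine problem and modular forms of weight 3/2*, Invent. Math. 72 (1983) 323–334, Theorem
of the Introduction; Koblitz, *Introduction to Elliptic Curves and Modular Forms*, Ch. IV §4). Let
`n` be odd and squarefree and assume BSD(RANK) for `E_n : y² = x³ - n² x`, i.e.
`ord_{s=1} L(E_n,s) = rank_ℤ E_n(ℚ)`. If `#{x² + 2y² + 8z² = n} = 2 · #{x² + 2y² + 32z² = n}`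
(counting over `ℤ³`), then `n` is a congruent number: by Tunnell's formula the count identity forces
`L(E_n,1) = 0`, so `r_an ≥ 1`, so under BSD(RANK) `rank ≥ 1`. The unconditional direction is
`Literature.NumberTheory.EllipticCurves.tunnell_odd`.
[cite: Tunnell1983Congruent, Theorem (Introduction, p. 323), converse part]
[cite: KoblitzECMF1993, Ch. IV §4, Tunnell's theorem] -/
def tunnell_converse_odd : Prop :=
  ∀ {n : ℕ} (hn : Squarefree n) (hodd : Odd n)
    (hBSD : (congruentNumberCurve n).analyticRank = (congruentNumberCurve n).mordellWeilRank)
    (h : Literature.NumberTheory.EllipticCurves.ternaryFormRepCount 1 2 8 n = 2 * Literature.NumberTheory.EllipticCurves.ternaryFormRepCount 1 2 32 n),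
    Literature.NumberTheory.EllipticCurves.IsCongruentNumber n

/-- **bsd.S29** (Tunnell's theorem, converse direction, even case; Tunnell, Invent. Math. 72
(1983), Theorem of the Introduction; Koblitz, *Introduction to Elliptic Curves and Modular Forms*,
Ch. IV §4). Let `n` be even and squarefree and assume BSD(RANK) for `E_n : y² = x³ - n² x`. If
`#{8x² + 2y² + 16z² = n} = 2 · #{8x² + 2y² + 64z² = n}` (counting over `ℤ³`; equivalently
`#{4x² + y² + 8z² = n/2} = 2 · #{4x² + y² + 32z² = n/2}`), then `n` is a congruent number. The
unconditional direction is `Literature.NumberTheory.EllipticCurves.tunnell_even`.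
[cite: Tunnell1983Congruent, Theorem (Introduction, p. 323), converse part]
[cite: KoblitzECMF1993, Ch. IV §4, Tunnell's theorem] -/
def tunnell_converse_even : Prop :=
  ∀ {n : ℕ} (hn : Squarefree n) (heven : Even n)
    (hBSD : (congruentNumberCurve n).analyticRank = (congruentNumberCurve n).mordellWeilRank)
    (h : Literature.NumberTheory.EllipticCurves.ternaryFormRepCount 8 2 16 n = 2 * Literature.NumberTheory.EllipticCurves.ternaryFormRepCount 8 2 64 n),
    Literature.NumberTheory.EllipticCurves.IsCongruentNumber n

end Tunnell

/-! ### bsd.S35 — Goldfeld / Conrad / Kuo–Murty -/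

section Goldfeld

variable (W : WeierstrassCurve ℚ) [W.IsElliptic] [W.IsGloballyMinimal]

/-- **bsd.S35** (Goldfeld, *Sur les produits partiels eulériens attachés aux courbes elliptiques*,
C. R. Acad. Sci. Paris 294 (1982) 471–474; K. Conrad, *Partial Euler products on the critical
line*, Canad. J. Math. 57 (2005), Thm 1.1 (Goldfeld) and Cor. 5.7; W. Kuo, M. R. Murty, *On a
conjecture of Birch and Swinnerton-Dyer*, Canad. J. Math. 57 (2005)). Let `E/ℚ` be an elliptic
curve given by a globally minimal Weierstrass equation `W` and let `N_p = W.reductionPointCount p`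
be the number of `𝔽_p`-points of its reduction modulo `p`. If the original Birch–Swinnerton-Dyer
asymptotic `∏_{p ≤ x} N_p / p ∼ C · (log x)^r` (`x → ∞`) holds for some constant `C > 0` and some
`r : ℕ`, then `L(E,s) ≠ 0` for `Re s > 1` (the Riemann hypothesis for `L(E,s)`) and
`r = ord_{s=1} L(E,s)` is the analytic rank. (Conrad states the hypothesis reciprocally as
`Prod(E,x) = ∏_{p ≤ x} L_p(E,1) ∼ C/(log x)^r`, his (1.2); the two are equivalent, his (1.1).)

Convention at bad primes: Mathlib's type of points of a (possibly singular) Weierstrass curve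
consists of the nonsingular affine points together with `O`, so at a prime `p` of bad reduction
`W.reductionPointCount p = #Ẽ_ns(𝔽_p) = p - a_p` with `a_p ∈ {1, -1, 0}` (split, non-split,
additive), while `N_p = p + 1 - a_p` at good `p`; in both cases `N_p / p = L_p(E,1)⁻¹` is the
inverse Euler factor, which is exactly Conrad's normalization (1.1). Kuo–Murty omit the finitely
many `p ∣ Δ`; this changes only the constant `C`, not the shape of the hypothesis.
[cite: Goldfeld1982, Théorème (p. 471)]
[cite: Conrad2005PartialEuler, Thm 1.1 and Cor. 5.7] -/
def analyticRank_eq_of_isEquivalent_prod : Prop :=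
  ∀ (r : ℕ) (C : ℝ) (hC : 0 < C)
    (h : (fun x : ℝ => ∏ p ∈ Finset.filter Nat.Prime (Finset.Iic ⌊x⌋₊),
        (W.reductionPointCount p : ℝ) / p) ~[atTop] fun x => C * Real.log x ^ r),
    W.analyticRank = r ∧ ∀ s : ℂ, 1 < s.re → W.entireLFunction s ≠ 0

end Goldfeld

end Literature.NumberTheory.EllipticCurves

end
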